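import Literature.AlgebraicGeometry.AbelianSchemes.DualPairBaseQuotientDescent
import Literature.AlgebraicGeometry.AbelianSchemes.SeesawSheafIffGraphCondRelative
import Literature.AlgebraicGeometry.AbelianSchemes.PoincareFamilyPointsInjective
import Literature.AlgebraicGeometry.AbelianSchemes.AbelianSchemeSeesawSubschemeAffineBase
import Literature.AlgebraicGeometry.AbelianSchemes.MumfordQuotientSliceInjective
import Summits.HodgeConjecture.HodgeConjecture.Theorems.F3DualAbelianSchemeMcStubN0
import Literature.AlgebraicGeometry.Morphisms.ClosedImmersionOfProperUnramifiedInjective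
import Literature.AlgebraicGeometry.AbelianSchemes.AbelianSchemeKOfL
import Literature.AlgebraicGeometry.AbelianSchemes.AbelianSchemeDualPairNormalize
import Literature.AlgebraicGeometry.Morphisms.ClosedImmersionIsoOfThickenings
import Literature.AlgebraicGeometry.Modules.DetClassTensor
import Literature.AlgebraicGeometry.Modules.DetClassDual
import Mathlib.FieldTheory.IsAlgClosed.Basic
import Literature.AlgebraicGeometry.AbelianSchemes.PoincareFamilyGraphFormallyUnramified
import Summits.HodgeConjecture.HodgeConjecture.Theorems.F3DualAbelianSchemeMcStubN3
import HarnessLib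

/-!
# F-3 (M) letter (Mc) `stub_F3Mc` — CLOSER: universality of `(Â′ = A′⁄K(L′), 𝒫′)` over ALL `T → S′` (Mumford §13, relative and algebraic)

Tree THEOREMS file (T2 of the F-3 closing ladder, cell hodgecm-mathlib; line `Cruxes/HDel/Lines/F3DualAbelianSchemeM.lean` ed. 4, letter (Mc)
`stub_F3Mc`).  It re-homes the registered (Mc) grandchild workfile `Cruxes/HDel/Lines/F3DualAbelianSchemeMc.lean` (v2.1d 377eae32, lead
B-p02 (g17)) as a sorry-free theorem file.  The third-layer letters are consumed BY NAME over their ★ closers — (N1′)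
`AbelianSchemeSeesawSubschemeAffineBase` (p792841) · (N2a′) `SeesawSheafIffGraphCondRelative` (p788539) · (N2b′)
`Theorems/F3DualAbelianSchemeMcN3Tower.N3.graphPoints_injective` (p796744, over ★ `MumfordQuotientSliceInjective`) · (N3d′)
`PoincareFamilyGraphFormallyUnramified` (p793807) · (N3′) `Theorems/F3DualAbelianSchemeMcStubN3.stub_McN3_holds` (p797055, the Artinian tower
S-a…S-f) · (W1) `Morphisms/ClosedImmersionOfProperUnramifiedInjective` (p792179) · (N0′) `Theorems/F3DualAbelianSchemeMcStubN0.stub_McN0_holds`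
(p793055); the four letters whose ★ heads are not literally the letter (N1′, N2a′, N3d′, W1) get 3-line wrappers in
`namespace …F3DualAbelianSchemeM.McClosure`.  §8 = [MumfordAV1970] §13 in the «mono, not étale» form (port of ★
`Residual.residual_affineFiniteType_of_M13`): the seesaw graph `Γ ↪ T × Â′ → T` (N1′ + N2a′) is proper and formally unramified (N3d′), injective
on geometric points (N2b′), hence a CLOSED IMMERSION (W1), through which every infinitesimal neighbourhood of every point factors (N3′), hence
an ISOMORPHISM (★ `Morphisms.isIso_of_isClosedImmersion_of_forall_factor`, all points); its inverse followed by `pr_{Â′}` classifies.  §9 HEAD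
`Summit.HodgeConjecture.CorCM.Cruxes.HypDel.F3DualAbelianSchemeM.stub_F3Mc_holds` = the (M) line's letter `stub_F3Mc` VERBATIM, from §8 + (N0′).
Consumed by T3 `Theorems/F3DualAbelianSchemeStubM` (B-p10 (g14) ∕ B-p11 (g21)).  HC_CM is proved only modulo the 7 printed citations until
rung 0 closes; nothing here is about HC.

## References
* [MumfordAV1970] D. Mumford, *Abelian Varieties* (1970), §13 (Theorem p. 125 and its proof, pp. 125–130); §10 (p. 89); §8 (p. 77).
* [MumfordFogartyKirwan1994] D. Mumford, J. Fogarty, F. Kirwan, *Geometric Invariant Theory*, 3rd ed. (1994), Ch. 6 §2 (p. 121).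
* [MilneAV2008] J. S. Milne, *Abelian Varieties* (2008), I §8 (pp. 36–37).
* [GortzWedhorn2023] U. Görtz, T. Wedhorn, *Algebraic Geometry II* (2023), Thm. 24.66; [GortzWedhorn2020] *Algebraic Geometry I*, (6.4) Prop. 6.7.
* [EGAIV4] A. Grothendieck, *EGA IV₄* (1967), Prop. 17.2.6, Cor. 18.12.6; [StacksProject] Tag 04XV.
* [Hartshorne1977] R. Hartshorne, *Algebraic Geometry* (1977), Ch. II Prop. 5.9 (p. 116).
-/

noncomputable section

open CategoryTheory CategoryTheory.Limits AlgebraicGeometry MonoidalCategory CartesianMonoidalCategory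
open scoped MonObj
open Literature.AlgebraicGeometry.AbelianSchemes Literature.AlgebraicGeometry.RelativeSpec
  Literature.AlgebraicGeometry.Motives Literature.AlgebraicGeometry.AbelianVarieties Literature.AlgebraicGeometry.Modules

namespace Summit.HodgeConjecture.CorCM.Cruxes.HypDel.F3DualAbelianSchemeM

namespace McClosure

/-! ## The (Mc) letters not already re-homed verbatim by ★ Theorems files (N1′, N2a′, N3d′, W1) -/

/-- (N1′) the relative SEESAW closed subscheme over the affine `S′` for a rank-one `𝓕` on `A′ × W`, `W → S′` locally of finite type —
BY NAME over ★ `AbelianSchemeOver.exists_seesawSubscheme_of_isAffine`. [cite: MumfordAV1970, §10 (p. 89)] [cite: GortzWedhorn2023, Thm. 24.66] -/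
theorem stub_McN1 : ∀ (R : Type) [CommRing R] [IsNoetherianRing R] [Algebra ℚ R] (A : AbelianSchemeOver (Spec (.of R)))
    {S' : Scheme.{0}} [IsAffine S'] (p : S' ⟶ Spec (.of R)) [IsFinite p] [Etale p]
    (W : Over S') [LocallyOfFiniteType W.hom] (𝓕 : ((A.baseChange p).X ⊗ W).left.Modules), HasRank 𝓕 1 →
    ∃ (Z : Over S') (i : Z ⟶ W) (_ : IsClosedImmersion i.left),
      ∀ (S : Over S') (u : S ⟶ W),
        (∃ v : S ⟶ Z, v ≫ i = u) ↔
          ∃ (𝓜 : S.left.Modules) (_ : HasRank 𝓜 1),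
            Nonempty ((Scheme.Modules.pullback ((A.baseChange p).X ◁ u).left).obj 𝓕 ≅
              (Scheme.Modules.pullback (CartesianMonoidalCategory.snd (A.baseChange p).X S).left).obj 𝓜) := by
  -- (N1′) DISCHARGED BY NAME (v2.1): ★ p792841 `AbelianSchemes/AbelianSchemeSeesawSubschemeAffineBase` (B-p12 (g18) ∕ F0P1c-p05 (g0))
  intro R _ _ _ A S' _ p _ _ W _ 𝓕 h𝓕
  haveI : IsLocallyNoetherian S' := LocallyOfFiniteType.isLocallyNoetherian p
  exact (A.baseChange p).exists_seesawSubscheme_of_isAffine W 𝓕 h𝓕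

/-- (N2a′) «rigidifications kill the twist»: base-triviality of the seesaw sheaf ⟺ the graph condition — BY NAME over ★
`AbelianSchemeOver.seesawSheaf_iff_graphCond`. [cite: MumfordAV1970, §13 (proof of the Thm. p. 125)] [cite: MilneAV2008, I §8 (pp. 36–37)] -/
theorem stub_McN2a : ∀ (R : Type) [CommRing R] [IsNoetherianRing R] [Algebra ℚ R] (A : AbelianSchemeOver (Spec (.of R)))
    {S' : Scheme.{0}} [IsAffine S'] (p : S' ⟶ Spec (.of R)) [IsFinite p] [Etale p]
    (hat : AbelianSchemeOver S') (P : ((A.baseChange p).prodLeft hat).Modules) (_h1 : HasRank P 1)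
    (_hrig : Nonempty ((Scheme.Modules.pullback ((A.baseChange p).unitSlice hat)).obj P ≅ SheafOfModules.unit _))
    (T' : Over S') (ℒ : (A.baseChange p).RigidifiedLineBundle T'.hom)
    (S : Over S') (u : S ⟶ T' ⊗ hat.X),
    (∃ (𝓜 : S.left.Modules) (_ : HasRank 𝓜 1),
      Nonempty ((Scheme.Modules.pullback ((A.baseChange p).X ◁ u).left).obj
        (tensorObj
          ((Scheme.Modules.pullback ((A.baseChange p).X ◁ CartesianMonoidalCategory.fst T' hat.X).left).obj ℒ.L)
          (Literature.AlgebraicGeometry.Modules.dual ((Scheme.Modules.pullback ((A.baseChange p).X ◁ CartesianMonoidalCategory.snd T' hat.X).left).obj P))) ≅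
        (Scheme.Modules.pullback (CartesianMonoidalCategory.snd (A.baseChange p).X S).left).obj 𝓜)) ↔
    Nonempty ((Scheme.Modules.pullback ((A.baseChange p).baseChangeToProd hat S.hom
        (u ≫ CartesianMonoidalCategory.snd T' hat.X).left (Over.w (u ≫ CartesianMonoidalCategory.snd T' hat.X)))).obj P ≅
      (Scheme.Modules.pullback ((A.baseChange p).X ◁ (u ≫ CartesianMonoidalCategory.fst T' hat.X)).left).obj ℒ.L) :=
  -- (N2a′) DISCHARGED BY NAME (v2): ★ p788539 `AbelianSchemeOver.seesawSheaf_iff_graphCond`, closer body of B-p08 (g15) J2 e48e3c37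
  fun _R _ _ _ A _S' _ p _ _ hat P h1 hrig _T' ℒ S u =>
    (A.baseChange p).seesawSheaf_iff_graphCond hat P ℒ h1 hrig S u

/-- (N3d′) the seesaw graph `Γ → T′` is FORMALLY UNRAMIFIED (first-order rigidity of `𝒫′` at every point) — over ★
`AbelianSchemeOver.formallyUnramified_fst_of_graph`. [cite: MumfordAV1970, §13 (proof of the Thm., pp. 125–129)] [cite: GortzWedhorn2020, (6.4) Prop. 6.7] -/
theorem stub_McN3d : ∀ (R : Type) [CommRing R] [IsNoetherianRing R] [Algebra ℚ R] (A : AbelianSchemeOver (Spec (.of R)))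
    (L : A.left.Modules) (hL : HasRank L 1)
    (_hε : CechPic.pullback A.unitSection (detClass (HasRank.isFiniteLocallyFree' hL)) = 1)
    {S' : Scheme.{0}} [IsAffine S'] (p : S' ⟶ Spec (.of R)) [IsFinite p] [Etale p]
    (hat : AbelianSchemeOver S') (π : (A.baseChange p).X ⟶ hat.X) [IsMonHom π]
    (_hπ : IsFinite π.left ∧ Etale π.left ∧ Surjective π.left)
    (P : ((A.baseChange p).prodLeft hat).Modules)
    (_hker : ∀ (T : Over S') (u : T ⟶ (A.baseChange p).X),
      u ≫ π = 1 ↔ (A.baseChange p).MemKOfL ((Scheme.Modules.pullback (pullback.fst A.X.hom p)).obj L) u)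
    (_h1 : HasRank P 1)
    (_hrig : Nonempty ((Scheme.Modules.pullback ((A.baseChange p).unitSlice hat)).obj P ≅ SheafOfModules.unit _))
    (_hsock : Nonempty ((Scheme.Modules.pullback ((A.baseChange p).X ◁ π).left).obj P ≅
      (A.baseChange p).mumfordBundle ((Scheme.Modules.pullback (pullback.fst A.X.hom p)).obj L)))
    (T' : Over S') [LocallyOfFiniteType T'.hom] (ℒ : (A.baseChange p).RigidifiedLineBundle T'.hom) (_hℒ : ℒ.FibrewisePicZero)
    (Γ : Over S') (i : Γ ⟶ T' ⊗ hat.X) [IsClosedImmersion i.left],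
    (∀ (S : Over S') (u : S ⟶ T' ⊗ hat.X), (∃ v : S ⟶ Γ, v ≫ i = u) ↔
      Nonempty ((Scheme.Modules.pullback ((A.baseChange p).baseChangeToProd hat S.hom
          (u ≫ CartesianMonoidalCategory.snd T' hat.X).left (Over.w (u ≫ CartesianMonoidalCategory.snd T' hat.X)))).obj P ≅
        (Scheme.Modules.pullback ((A.baseChange p).X ◁ (u ≫ CartesianMonoidalCategory.fst T' hat.X)).left).obj ℒ.L)) →
    FormallyUnramified (i ≫ CartesianMonoidalCategory.fst T' hat.X).left := by
  -- (N3d′) over ★ p793807 `AbelianSchemes/PoincareFamilyGraphFormallyUnramified` (B-p02 (g17); ★ p791848 §4 + ★ p787816 inside)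
  intro R _ _ _ A L hL hε S' _ p _ _ hat π _ hπ P hker _h1 _hrig hsock T' _ ℒ _hℒ Γ i _ hΓ
  haveI : IsLocallyNoetherian S' := LocallyOfFiniteType.isLocallyNoetherian p
  haveI : Etale π.left := hπ.2.1
  haveI : Surjective π.left := hπ.2.2
  exact (A.baseChange p).formallyUnramified_fst_of_graph hat π (hasRank_pullback _ hL)
    (AbelianSchemeOver.cechPic_pullback_unitSection_baseChange_eq_one A p hL hε) hker P hsock T' ℒ Γ i hΓ

/-- (W1) locally of finite type + formally unramified + proper + injective on geometric points ⇒ CLOSED IMMERSION — BY NAME over ★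
`Morphisms.isClosedImmersion_of_forall_injective_geometricPoints`. [cite: EGAIV4, Prop. 17.2.6 and Cor. 18.12.6] [cite: StacksProject, Tag 04XV] -/
theorem socket_McW1 : ∀ {X Y : Scheme.{0}} (f : X ⟶ Y) [FormallyUnramified f] [IsProper f],
    (∀ (Ω : Type) [Field Ω] [IsAlgClosed Ω] (x₁ x₂ : Spec (.of Ω) ⟶ X), x₁ ≫ f = x₂ ≫ f → x₁ = x₂) →
    IsClosedImmersion f := by
  -- (W1) DISCHARGED BY NAME (v2.1): ★ p792179 `Morphisms/ClosedImmersionOfProperUnramifiedInjective` (B-p03 (g20))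
  exact fun f _ _ hinj => Literature.AlgebraicGeometry.Morphisms.isClosedImmersion_of_forall_injective_geometricPoints f hinj

/-! ## §8 THE COMPOSITION over an affine finite-type `T → S′` (★ `Residual.residual_affineFiniteType_of_M13` ported) -/

section Composition

variable (R : Type) [CommRing R] [IsNoetherianRing R] [Algebra ℚ R] (A : AbelianSchemeOver (Spec (.of R)))
    (L : A.left.Modules) (hL : HasRank L 1)
    (hε : CechPic.pullback A.unitSection (detClass (HasRank.isFiniteLocallyFree' hL)) = 1)
    (hΘ : ∀ ⦃Ω : Type⦄ [Field Ω] [IsAlgClosed Ω] (s : Spec (.of Ω) ⟶ Spec (.of R)),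
      ∃ Θ : CartierDivisor (A.fibre s).toAbelianVariety.X.left, Θ.IsAmple ∧
        CechPic.pullback (X := (A.fibre s).toAbelianVariety.X.left) (pullback.fst A.X.hom s)
          (detClass (HasRank.isFiniteLocallyFree' hL)) = Θ.cechClass)
    {S' : Scheme.{0}} [IsAffine S'] (p : S' ⟶ Spec (.of R)) [IsFinite p] [Etale p] [Surjective p]
    (hat : AbelianSchemeOver S') (π : (A.baseChange p).X ⟶ hat.X) [IsMonHom π]
    (hπ : IsFinite π.left ∧ Etale π.left ∧ Surjective π.left)
    (P : ((A.baseChange p).prodLeft hat).Modules)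
    (hker : ∀ (T : Over S') (u : T ⟶ (A.baseChange p).X),
      u ≫ π = 1 ↔ (A.baseChange p).MemKOfL ((Scheme.Modules.pullback (pullback.fst A.X.hom p)).obj L) u)
    (h1 : HasRank P 1)
    (hrig : Nonempty ((Scheme.Modules.pullback ((A.baseChange p).unitSlice hat)).obj P ≅ SheafOfModules.unit _))
    (hsock : Nonempty ((Scheme.Modules.pullback ((A.baseChange p).X ◁ π).left).obj P ≅
      (A.baseChange p).mumfordBundle ((Scheme.Modules.pullback (pullback.fst A.X.hom p)).obj L)))

include hε hΘ hπ hker h1 hrig hsock in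
set_option backward.isDefEq.respectTransparency false in
/-- **ROAD M13 RELATIVE TO `S′`, OVER AN AFFINE FINITE-TYPE BASE** ([MumfordAV1970] §13 (proof of the Theorem p. 125) in the «mono, not
étale» form; port of ★ `Residual.residual_affineFiniteType_of_M13`): the seesaw graph `Γ ↪ T × Â′ → T` (N1′ + N2a′) is proper (`Â′`
proper) and formally unramified (N3d′), injective on geometric points (N2b′) hence a CLOSED IMMERSION (W1), through which every
infinitesimal neighbourhood of every point factors (N3′), hence an ISOMORPHISM (★ `Morphisms.isIso_of_isClosedImmersion_of_forall_factor`,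
all points); its inverse followed by `pr_{Â′}` is the unique classifying map. [cite: MumfordAV1970, §13 (Thm. p. 125 and its proof)]
[cite: Hartshorne1977, Ch. II, Prop. 5.9 (p. 116)] -/
theorem stub_F3Mc_affineFiniteType_of (T' : Over S') [IsAffine T'.left] [LocallyOfFiniteType T'.hom]
    (ℒ : (A.baseChange p).RigidifiedLineBundle T'.hom) (hℒ : ℒ.FibrewisePicZero) :
    ∃! g : {g : T'.left ⟶ hat.X.left // g ≫ hat.X.hom = T'.hom},
      Nonempty ((Scheme.Modules.pullback ((A.baseChange p).baseChangeToProd hat T'.hom g.1 g.2)).obj P ≅ ℒ.L) := by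
  -- `Â′` and the instances
  haveI := hat.isProper
  haveI := hat.isSmooth
  haveI : IsLocallyNoetherian S' := LocallyOfFiniteType.isLocallyNoetherian p
  haveI : IsLocallyNoetherian T'.left := LocallyOfFiniteType.isLocallyNoetherian T'.hom
  -- the functor of points we represent = the graph condition, SPELLED OUT (D1); an opaque local name with its unfolding
  obtain ⟨GC, hGC⟩ : ∃ GC : ∀ (S : Over S') (_ : S ⟶ T' ⊗ hat.X), Prop, ∀ (S : Over S') (u : S ⟶ T' ⊗ hat.X), GC S u ↔
      Nonempty ((Scheme.Modules.pullback ((A.baseChange p).baseChangeToProd hat S.hom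
          (u ≫ CartesianMonoidalCategory.snd T' hat.X).left (Over.w (u ≫ CartesianMonoidalCategory.snd T' hat.X)))).obj P ≅
        (Scheme.Modules.pullback ((A.baseChange p).X ◁ (u ≫ CartesianMonoidalCategory.fst T' hat.X)).left).obj ℒ.L) :=
    ⟨_, fun _ _ => Iff.rfl⟩
  -- (N1′ + N2a′) the seesaw graph `Γ ↪ T × Â′` with `Γ(S) = {u ; GC u}`
  haveI : LocallyOfFiniteType (CartesianMonoidalCategory.fst T' hat.X).left :=
    inferInstanceAs (LocallyOfFiniteType (pullback.fst T'.hom hat.X.hom))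
  haveI : LocallyOfFiniteType (T' ⊗ hat.X).hom := by
    rw [← Over.w (CartesianMonoidalCategory.fst T' hat.X)]
    infer_instance
  have h𝓕1 : HasRank (tensorObj
      ((Scheme.Modules.pullback ((A.baseChange p).X ◁ CartesianMonoidalCategory.fst T' hat.X).left).obj ℒ.L)
      (Literature.AlgebraicGeometry.Modules.dual
        ((Scheme.Modules.pullback ((A.baseChange p).X ◁ CartesianMonoidalCategory.snd T' hat.X).left).obj P))) 1 :=
    hasRank_tensorObj_one (hasRank_pullback _ ℒ.hasRank_one) (hasRank_dual (hasRank_pullback _ h1))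
  obtain ⟨Γ, i, hi, hZ⟩ := stub_McN1 R A p (T' ⊗ hat.X) _ h𝓕1
  haveI := hi
  have hΓ' : ∀ (S : Over S') (u : S ⟶ T' ⊗ hat.X), (∃ v : S ⟶ Γ, v ≫ i = u) ↔
      Nonempty ((Scheme.Modules.pullback ((A.baseChange p).baseChangeToProd hat S.hom
          (u ≫ CartesianMonoidalCategory.snd T' hat.X).left (Over.w (u ≫ CartesianMonoidalCategory.snd T' hat.X)))).obj P ≅
        (Scheme.Modules.pullback ((A.baseChange p).X ◁ (u ≫ CartesianMonoidalCategory.fst T' hat.X)).left).obj ℒ.L) :=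
    fun S u => (hZ S u).trans (stub_McN2a R A p hat P h1 hrig T' ℒ S u)
  have hΓ : ∀ (S : Over S') (u : S ⟶ T' ⊗ hat.X), (∃ v : S ⟶ Γ, v ≫ i = u) ↔ GC S u := fun S u =>
    (hΓ' S u).trans (hGC S u).symm
  -- instances along `q := i ≫ pr_T : Γ → T`
  haveI : IsProper (CartesianMonoidalCategory.fst T' hat.X).left :=
    inferInstanceAs (IsProper (pullback.fst T'.hom hat.X.hom))
  haveI : IsProper (i ≫ CartesianMonoidalCategory.fst T' hat.X).left := by
    change IsProper (i.left ≫ (CartesianMonoidalCategory.fst T' hat.X).left)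
    infer_instance
  haveI : LocallyOfFiniteType Γ.hom := by
    rw [← Over.w (i ≫ CartesianMonoidalCategory.fst T' hat.X)]
    infer_instance
  haveI : Mono i := (Over.forget _).mono_of_mono_map (inferInstanceAs (Mono i.left))
  -- (N3d′) formally unramified
  haveI : FormallyUnramified (i ≫ CartesianMonoidalCategory.fst T' hat.X).left :=
    stub_McN3d R A L hL hε p hat π hπ P hker h1 hrig hsock T' ℒ hℒ Γ i hΓ'
  -- (N2b′) injective on geometric points, hence (W1) a closed immersion
  have hinj : ∀ (Ω : Type) [Field Ω] [IsAlgClosed Ω] (x₁ x₂ : Spec (.of Ω) ⟶ Γ.left),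
      x₁ ≫ (i ≫ CartesianMonoidalCategory.fst T' hat.X).left = x₂ ≫ (i ≫ CartesianMonoidalCategory.fst T' hat.X).left →
        x₁ = x₂ := by
    intro Ω _ _ x₁ x₂ h12
    obtain ⟨s, hs₁⟩ : ∃ s : Spec (.of Ω) ⟶ S', x₁ ≫ Γ.hom = s := ⟨_, rfl⟩
    have hs₂ : x₂ ≫ Γ.hom = s := by
      rw [← hs₁, ← Over.w (i ≫ CartesianMonoidalCategory.fst T' hat.X), ← Category.assoc, ← Category.assoc, h12]
    obtain ⟨o₁, ho₁⟩ : ∃ o₁ : Over.mk s ⟶ Γ, o₁.left = x₁ := ⟨Over.homMk x₁ hs₁, rfl⟩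
    obtain ⟨o₂, ho₂⟩ : ∃ o₂ : Over.mk s ⟶ Γ, o₂.left = x₂ := ⟨Over.homMk x₂ hs₂, rfl⟩
    have hx : o₁ ≫ i ≫ CartesianMonoidalCategory.fst T' hat.X = o₂ ≫ i ≫ CartesianMonoidalCategory.fst T' hat.X :=
      Over.OverMorphism.ext (by simp only [Over.comp_left, ho₁, ho₂] at h12 ⊢; exact h12)
    have g₁ := (hΓ' _ _).mp ⟨o₁, rfl⟩
    have g₂ := (hΓ' _ _).mp ⟨o₂, rfl⟩
    have hyy := F3DualAbelianSchemeMc.N3.graphPoints_injective R A L hL p hat π hπ P hker h1 hsock T' ℒ hℒ s (o₁ ≫ i) (o₂ ≫ i)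
      (by simpa only [Category.assoc] using hx) g₁ g₂
    have hoi : o₁ ≫ i = o₂ ≫ i := by
      apply CartesianMonoidalCategory.hom_ext
      · simpa only [Category.assoc] using hx
      · simpa only [Category.assoc] using hyy
    have ho : o₁ = o₂ := (cancel_mono i).1 hoi
    rw [← ho₁, ← ho₂, ho]
  haveI : IsClosedImmersion (i ≫ CartesianMonoidalCategory.fst T' hat.X).left := socket_McW1 _ hinj
  -- (N3′) every infinitesimal neighbourhood factors, hence an isomorphism
  haveI : IsIso (i ≫ CartesianMonoidalCategory.fst T' hat.X).left :=
    Literature.AlgebraicGeometry.Morphisms.isIso_of_isClosedImmersion_of_forall_factor _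
      (F3DualAbelianSchemeMc.stub_McN3_holds R A L hL hε hΘ p hat π hπ P hker h1 hrig hsock T' ℒ hℒ Γ i hΓ')
  haveI : IsIso ((Over.forget S').map (i ≫ CartesianMonoidalCategory.fst T' hat.X)) := by
    change IsIso (i ≫ CartesianMonoidalCategory.fst T' hat.X).left
    infer_instance
  haveI : IsIso (i ≫ CartesianMonoidalCategory.fst T' hat.X) :=
    isIso_of_reflects_iso (i ≫ CartesianMonoidalCategory.fst T' hat.X) (Over.forget S')
  -- the section and the conclusion
  obtain ⟨σ, hσ⟩ : ∃ σ : T' ⟶ hat.X,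
      σ = inv (i ≫ CartesianMonoidalCategory.fst T' hat.X) ≫ i ≫ CartesianMonoidalCategory.snd _ _ := ⟨_, rfl⟩
  have hsec : inv (i ≫ CartesianMonoidalCategory.fst T' hat.X) ≫ i = CartesianMonoidalCategory.lift (𝟙 _) σ := by
    apply CartesianMonoidalCategory.hom_ext
    · rw [CartesianMonoidalCategory.lift_fst, Category.assoc, IsIso.inv_hom_id]
    · rw [CartesianMonoidalCategory.lift_snd, Category.assoc, hσ]
  -- the graph condition at a section `(1, s)` IS the universal-property clause for `g = s`
  have hlift : ∀ s : T' ⟶ hat.X, GC _ (CartesianMonoidalCategory.lift (𝟙 _) s) ↔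
      Nonempty ((Scheme.Modules.pullback ((A.baseChange p).baseChangeToProd hat T'.hom s.left (Over.w s))).obj P ≅ ℒ.L) := by
    intro s
    rw [hGC]
    have hφ : (A.baseChange p).baseChangeToProd hat T'.hom
          (CartesianMonoidalCategory.lift (𝟙 _) s ≫ CartesianMonoidalCategory.snd _ _).left
          (Over.w (CartesianMonoidalCategory.lift (𝟙 _) s ≫ CartesianMonoidalCategory.snd _ _)) =
        (A.baseChange p).baseChangeToProd hat T'.hom s.left (Over.w s) :=
      AbelianSchemeOver.baseChangeToProd_congr _ _ _ (by rw [CartesianMonoidalCategory.lift_snd]) _ _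
    have e₁ := congrArg (fun φ => (Scheme.Modules.pullback φ).obj P) hφ
    have hw : ((A.baseChange p).X ◁ (CartesianMonoidalCategory.lift (𝟙 T') s ≫ CartesianMonoidalCategory.fst _ _)).left =
        𝟙 _ := by
      rw [CartesianMonoidalCategory.lift_fst, MonoidalCategory.whiskerLeft_id, Over.id_left]
    have e₂ : (Scheme.Modules.pullback ((A.baseChange p).X ◁
          (CartesianMonoidalCategory.lift (𝟙 T') s ≫ CartesianMonoidalCategory.fst _ _)).left).obj ℒ.L ≅ ℒ.L :=
      eqToIso (congrArg (fun φ => (Scheme.Modules.pullback φ).obj ℒ.L) hw) ≪≫ (Scheme.Modules.pullbackId _).app ℒ.L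
    exact ⟨fun ⟨φ⟩ => ⟨(eqToIso e₁).symm ≪≫ φ ≪≫ e₂⟩, fun ⟨ψ⟩ => ⟨eqToIso e₁ ≪≫ ψ ≪≫ e₂.symm⟩⟩
  have hcσ : GC _ (CartesianMonoidalCategory.lift (𝟙 _) σ) := hsec ▸ (hΓ _ _).mp ⟨_, rfl⟩
  refine ⟨⟨σ.left, Over.w σ⟩, (hlift σ).mp hcσ, ?_⟩
  rintro ⟨g', hg'⟩ hψ
  obtain ⟨s', hs'⟩ : ∃ s' : T' ⟶ hat.X, s'.left = g' := ⟨Over.homMk g' hg', rfl⟩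
  subst hs'
  have hc' : GC _ (CartesianMonoidalCategory.lift (𝟙 _) s') := (hlift s').mpr hψ
  obtain ⟨v, hv⟩ := (hΓ _ _).mpr hc'
  have hvp : v ≫ (i ≫ CartesianMonoidalCategory.fst T' hat.X) = 𝟙 _ := by
    rw [← Category.assoc, hv, CartesianMonoidalCategory.lift_fst]
  have hv' : v = inv (i ≫ CartesianMonoidalCategory.fst T' hat.X) := by
    rw [← cancel_mono (i ≫ CartesianMonoidalCategory.fst T' hat.X), hvp, IsIso.inv_hom_id]
  have hs : s' = σ := by
    rw [← CartesianMonoidalCategory.lift_snd (𝟙 _) s', ← hv, hv', Category.assoc, hσ]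
  exact Subtype.ext (congrArg (fun s => s.left) hs)

end Composition

end McClosure

/-! ## §9 THE HEAD — the child-line letter (Mc) `stub_F3Mc` VERBATIM, PROVED from §8 + N0′ -/

/-- **HEAD `stub_F3Mc_holds`** = letter (Mc) of `Cruxes/HDel/Lines/F3DualAbelianSchemeM.lean` ed. 4 (8047f009), statement VERBATIM,
PROVED: N0′ reduces to an affine finite-type base, settled by §8.  [cite: MumfordAV1970, §13 Theorem (p. 125)]
[cite: MumfordFogartyKirwan1994, Ch. 6 §2 (p. 121)] [cite: MilneAV2008, I §8 pp. 36–37] -/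
theorem stub_F3Mc_holds : ∀ (R : Type) [CommRing R] [IsNoetherianRing R] [Algebra ℚ R] (A : AbelianSchemeOver (Spec (.of R)))
    (L : A.left.Modules) (hL : HasRank L 1)
    (_hε : CechPic.pullback A.unitSection (detClass (HasRank.isFiniteLocallyFree' hL)) = 1)
    (_hΘ : ∀ ⦃Ω : Type⦄ [Field Ω] [IsAlgClosed Ω] (s : Spec (.of Ω) ⟶ Spec (.of R)),
      ∃ Θ : CartierDivisor (A.fibre s).toAbelianVariety.X.left, Θ.IsAmple ∧
        CechPic.pullback (X := (A.fibre s).toAbelianVariety.X.left) (pullback.fst A.X.hom s)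
          (detClass (HasRank.isFiniteLocallyFree' hL)) = Θ.cechClass)
    {S' : Scheme.{0}} [IsAffine S'] (p : S' ⟶ Spec (.of R)) [IsFinite p] [Etale p] [Surjective p]
    (hat : AbelianSchemeOver S') (π : (A.baseChange p).X ⟶ hat.X) [IsMonHom π]
    (_hπ : IsFinite π.left ∧ Etale π.left ∧ Surjective π.left)
    (P : ((A.baseChange p).prodLeft hat).Modules)
    (_hker : ∀ (T : Over S') (u : T ⟶ (A.baseChange p).X),
      u ≫ π = 1 ↔ (A.baseChange p).MemKOfL ((Scheme.Modules.pullback (pullback.fst A.X.hom p)).obj L) u)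
    (_h1 : HasRank P 1)
    (_hrig : Nonempty ((Scheme.Modules.pullback ((A.baseChange p).unitSlice hat)).obj P ≅ SheafOfModules.unit _))
    (_hsock : Nonempty ((Scheme.Modules.pullback ((A.baseChange p).X ◁ π).left).obj P ≅
      (A.baseChange p).mumfordBundle ((Scheme.Modules.pullback (pullback.fst A.X.hom p)).obj L))),
    ∀ {T : Scheme.{0}} (f : T ⟶ S') (ℒ : (A.baseChange p).RigidifiedLineBundle f), ℒ.FibrewisePicZero →
      ∃! g : {g : T ⟶ hat.X.left // g ≫ hat.X.hom = f},
        Nonempty ((Scheme.Modules.pullback ((A.baseChange p).baseChangeToProd hat f g.1 g.2)).obj P ≅ ℒ.L) := by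
  intro R _ _ _ A L hL hε hΘ S' _ p _ _ _ hat π _ hπ P hker h1 hrig hsock
  exact F3DualAbelianSchemeMc.stub_McN0_holds R A L hL hε hΘ p hat π hπ P hker h1 hrig hsock
    (fun f hT hfT ℒ hℒ => by
      haveI : IsAffine (Over.mk f).left := hT
      haveI : LocallyOfFiniteType (Over.mk f).hom := hfT
      exact McClosure.stub_F3Mc_affineFiniteType_of R A L hL hε hΘ p hat π hπ P hker h1 hrig hsock (Over.mk f) ℒ hℒ)

end Summit.HodgeConjecture.CorCM.Cruxes.HypDel.F3DualAbelianSchemeM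

end
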